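import Mathlib
import HarnessLib
import Summits.HubbardSuperconductivity.HubbardSuperconductivity.Theorems.KLProgrammeKLRegimeEngineTowerQuarticIncrement

/-!
# Route `KLProgramme` — crux K3 ENGINE (stmt-HubbardSuperconductivity-20437 `KLRegimeEngineV17F2`), stub (b): the blocked-tower bookkeeping,
# part 10 — the TWO-LEG INCREMENT of a block step is `O(λ)` (E1 lead r2d-p2 g6; the E1 side of plan g17's (R47m) class-#7 question
# `TwoLegDualMomentsAt`: does the m = 2 (weighted) output line ride the (b) induction at marginal cost?)

Sibling of part 6 (`towerQuarticIncrement_le`, output degree `4`, `O(λ²)`) at output degree `2`.  The tower never FEEDS BACK its two-leg output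
(relevant direction; renormalisation handles it), but the (e) lane's class #7 reads the two-leg kernel BORN in one block step at the frame `K_n`
(dual-lattice moments of `𝒱⁽ⁿ⁾[K_n] − 𝒩_{K_n}` = a WEIGHTED two-leg size).  The same honest bookkeeping as at degree four applies: every input of
the step is `O(λ)` (`μ m ≤ λ·ν m` on `[1, D]`), so the order-`n ≥ 2` graded terms carry `λⁿ ≤ λ²`, and the first order at `p = 1` — the tadpoles
`C(2m,2) σ^{m−1} μ(m)`, `m ≥ 2` — carries ONE `λ` (the quartic input's `6σ·μ(2) ≤ 6σλ·ν(2)` and the `2m ≥ 6` kernels' `λ^{m−1}`):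

* `towerFO_one_le` — `towerFO D σ μ 1 ≤ λ·(6σ·ν 2 + 16·A'σQ'²/(1 − x₁))`, `x₁ = 4σλQ'`;
* **`towerTwoLegIncrement_le`** — with the suppliers' step hypothesis at `p = 1`:
  **`b ≤ λ·(6σ·ν 2 + 16·A'σQ'²/(1 − x₁)) + λ²·e·ψ·Φ·G′²/(1 − ΦλG′)`** — `n`-free, no `λ`-free smallness.
Currency-blind (plain or weighted pinned sums alike, given the suppliers — for class #7 the weighted suppliers are those of W2); so on the
dimensionless side the m = 2 export costs exactly this file.  Pure real analysis; nothing about the model is asserted.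
-/

noncomputable section

namespace Summit.HubbardSuperconductivity.HubbardSuperconductivity.Theorems.EngineV8

set_option linter.dupNamespace false -- summit = problem name (single-conjunct summit), D-0017

open Real Finset

/-- **First order at output degree two**: the tadpole of the quartic input and the self-contractions of the `2m ≥ 6` kernels,
`towerFO D σ μ 1 ≤ λ·(6σ·ν 2 + 16·A'σQ'²/(1 − x₁))` for `μ 2 ≤ λ·ν 2`, `μ m ≤ A'λ^{m−1}Q'^m` (`3 ≤ m ≤ D`), `x₁ = 4σλQ' < 1`. -/
theorem towerFO_one_le {D : ℕ} {σ A' lam Q' : ℝ} {μ ν : ℕ → ℝ} (hσ : 0 ≤ σ) (hA' : 0 ≤ A') (hlam : 0 ≤ lam) (hQ' : 0 ≤ Q')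
    (hμ0 : ∀ m, 0 ≤ μ m) (hν0 : ∀ m, 0 ≤ ν m) (hμν : ∀ m, 1 ≤ m → m ≤ D → μ m ≤ lam * ν m)
    (hprof : ∀ m, 3 ≤ m → m ≤ D → μ m ≤ A' * lam ^ (m - 1) * Q' ^ m) (hx₁ : 4 * σ * lam * Q' < 1) :
    towerFO D σ μ 1 ≤ lam * (6 * σ * ν 2 + 16 * A' * σ * Q' ^ 2 / (1 - 4 * σ * lam * Q')) := by
  have hx0 : 0 ≤ 4 * σ * lam * Q' := by positivity
  have hx1' : 0 < 1 - 4 * σ * lam * Q' := sub_pos.2 hx₁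
  -- split the inputs: the quartic one, and the kernels of degree `2m ≥ 6`
  set μ₂ : ℕ → ℝ := fun m => if m = 2 then μ m else 0 with hμ₂
  set μ₃ : ℕ → ℝ := fun m => if 3 ≤ m then μ m else 0 with hμ₃
  have hμ₃0 : ∀ m, 0 ≤ μ₃ m := fun m => by rw [hμ₃]; dsimp only; split_ifs; exacts [hμ0 m, le_rfl]
  have hprof₃ : ∀ m, 1 ≤ m → m ≤ D → μ₃ m ≤ A' * lam ^ (m - 1) * Q' ^ m := fun m _ hmD => by
    rw [hμ₃]; dsimp only; split_ifs with h3
    · exact hprof m h3 hmD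
    · positivity
  have hsplit : towerFO D σ μ 1 = towerFO D σ μ₂ 1 + towerFO D σ μ₃ 1 := by
    unfold towerFO
    rw [← sum_add_distrib]
    refine sum_congr rfl fun m hm => ?_
    have hm2 : 2 ≤ m := by have := (mem_Ioc.1 hm).1; omega
    rw [hμ₂, hμ₃]
    dsimp only
    by_cases h2 : m = 2
    · subst h2; simp
    · rw [if_neg h2, if_pos (by omega)]; ring
  -- the quartic input's tadpole
  have h₂ : towerFO D σ μ₂ 1 ≤ lam * (6 * σ * ν 2) := by
    unfold towerFO
    have hterm : ∀ m ∈ Ioc 1 D, ((2 * m).choose (2 * 1) : ℝ) * σ ^ (m - 1) * μ₂ m = if m = 2 then 6 * σ * μ 2 else 0 := by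
      intro m _
      rw [hμ₂]
      dsimp only
      split_ifs with h2
      · subst h2
        have h6 : (((2 * 2).choose (2 * 1) : ℕ) : ℝ) = 6 := by exact_mod_cast (by decide : (2 * 2).choose (2 * 1) = 6)
        rw [h6, show (2 : ℕ) - 1 = 1 from rfl, pow_one]
      · rw [mul_zero]
    rw [sum_congr rfl hterm, sum_ite_eq']
    split_ifs with hD
    · calc 6 * σ * μ 2 ≤ 6 * σ * (lam * ν 2) := by
            have := hμν 2 (by norm_num) (mem_Ioc.1 hD).2; gcongr
        _ = lam * (6 * σ * ν 2) := by ring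
    · have := hν0 2; positivity
  -- the `2m ≥ 6` kernels' self-contractions
  have h₃ : towerFO D σ μ₃ 1 ≤ lam * (16 * A' * σ * Q' ^ 2 / (1 - 4 * σ * lam * Q')) := by
    refine (towerFO_le hσ hA' hlam hQ' hμ₃0 hprof₃ hx₁ (p := 1) le_rfl).trans (le_of_eq ?_)
    rw [show (1 : ℕ) - 1 = 0 from rfl, pow_zero, pow_one, div_eq_mul_inv, div_eq_mul_inv]
    ring
  rw [hsplit, mul_add]
  exact add_le_add h₂ h₃

/-- **The two-leg increment of a block step is `O(λ)`.**  Inputs: `0 ≤ μ`, EVERY degree `O(λ)` — `μ m ≤ λ·ν m` on `[1, D]` with `0 ≤ ν` and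
`Σ_{δ∈[1,D]} τ^δ ν δ ≤ G′` (e.g. `sum_nu_threePiece_le`) — and the recursive profile `μ m ≤ A'λ^{m−1}Q'^m` in degrees `2m ≥ 6` (for the first
order); smallness `x₁ = 4σλQ' < 1`, `Φ·λ·G′ < 1`, `towerV D τ μ ≤ V̄` with `ΦV̄ < 1`; the suppliers' step hypothesis at `p = 1` (∀ N ≥ 2, guard
`ΦV < 1`).  Then `b ≤ λ·(6σ·ν 2 + 16·A'σQ'²/(1 − x₁)) + λ²·e·ψ·Φ·G′²/(1 − ΦλG′)` — first order `O(λ)` (one tadpole of the quartic input),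
orders `n ≥ 2` at `λⁿ ≤ λ²`; `n`-free; no `λ`-free condition. -/
theorem towerTwoLegIncrement_le {D : ℕ} {μ ν : ℕ → ℝ} {b σ Φ ψ τ lam A' Q' G' Vb : ℝ}
    (hσ : 0 ≤ σ) (hΦ : 0 ≤ Φ) (hψ : 0 ≤ ψ) (hτ : 0 ≤ τ) (hlam : 0 ≤ lam) (hA' : 0 ≤ A') (hQ' : 0 ≤ Q')
    (hμ0 : ∀ m, 0 ≤ μ m) (hν0 : ∀ m, 0 ≤ ν m) (hμν : ∀ m, 1 ≤ m → m ≤ D → μ m ≤ lam * ν m)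
    (hG' : ∑ δ ∈ Icc 1 D, τ ^ δ * ν δ ≤ G') (hprof : ∀ m, 3 ≤ m → m ≤ D → μ m ≤ A' * lam ^ (m - 1) * Q' ^ m)
    (hx₁ : 4 * σ * lam * Q' < 1) (hy : Φ * lam * G' < 1) (hVb : towerV D τ μ ≤ Vb) (hθ : Φ * Vb < 1)
    (hstep : ∀ N : ℕ, 2 ≤ N → Φ * towerV D τ μ < 1 →
      b ≤ towerFO D σ μ 1 + ∑ n ∈ Icc 2 N, exp 1 * Φ ^ (n - 1) * ψ ^ 1 * towerS D τ μ n 1 +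
        ψ ^ 1 * exp 1 * towerV D τ μ * (Φ * towerV D τ μ) ^ N / (1 - Φ * towerV D τ μ)) :
    b ≤ lam * (6 * σ * ν 2 + 16 * A' * σ * Q' ^ 2 / (1 - 4 * σ * lam * Q')) + lam ^ 2 * (exp 1 * ψ * Φ * G' ^ 2 / (1 - Φ * lam * G')) := by
  set V := towerV D τ μ with hVdef
  have hV0 : 0 ≤ V := towerV_nonneg hτ hμ0
  have hθ0 : 0 ≤ Φ * V := mul_nonneg hΦ hV0
  have hθle : Φ * V ≤ Φ * Vb := mul_le_mul_of_nonneg_left hVb hΦ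
  have hθ1 : Φ * V < 1 := hθle.trans_lt hθ
  have hθb0 : 0 ≤ Φ * Vb := hθ0.trans hθle
  have hVb0 : 0 ≤ Vb := hV0.trans hVb
  have hG'0 : 0 ≤ G' := (sum_nonneg fun δ _ => by have := hν0 δ; positivity).trans hG'
  have hy0 : 0 ≤ Φ * lam * G' := by positivity
  set F := lam * (6 * σ * ν 2 + 16 * A' * σ * Q' ^ 2 / (1 - 4 * σ * lam * Q')) with hF
  set M := exp 1 * ψ * Φ * lam ^ 2 * G' ^ 2 with hM
  have hM0 : 0 ≤ M := by positivity
  set T : ℕ → ℝ := fun N => ψ * exp 1 * Vb * (Φ * Vb) ^ N / (1 - Φ * Vb) with hT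
  -- graded partial sums: order `n` carries `λⁿ = λ²·λ^{n−2}`
  have hGr : ∀ N, ∑ n ∈ Icc 2 N, exp 1 * Φ ^ (n - 1) * ψ ^ 1 * towerS D τ μ n 1 ≤ M * (1 / (1 - Φ * lam * G')) := by
    intro N
    have hterm : ∀ n ∈ Icc 2 N, exp 1 * Φ ^ (n - 1) * ψ ^ 1 * towerS D τ μ n 1 ≤ M * (Φ * lam * G') ^ (n - 2) := by
      intro n hn
      have hn2 : 2 ≤ n := (mem_Icc.1 hn).1
      have hS := towerS_le_pow_of_le_mul (D := D) hτ hμ0 hμν n 1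
      have hS0 : 0 ≤ ∑ δ ∈ Icc 1 D, τ ^ δ * ν δ := sum_nonneg fun δ _ => by have := hν0 δ; positivity
      have hpow : lam ^ n * (∑ δ ∈ Icc 1 D, τ ^ δ * ν δ) ^ n ≤ lam ^ n * G' ^ n :=
        mul_le_mul_of_nonneg_left (pow_le_pow_left₀ hS0 hG' n) (by positivity)
      calc exp 1 * Φ ^ (n - 1) * ψ ^ 1 * towerS D τ μ n 1 ≤ exp 1 * Φ ^ (n - 1) * ψ ^ 1 * (lam ^ n * G' ^ n) := by
            have := towerS_nonneg hτ hμ0 n 1 (D := D); have := hS.trans hpow; gcongr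
        _ = M * (Φ * lam * G') ^ (n - 2) := by
            rw [hM, pow_one]
            obtain ⟨j, rfl⟩ : ∃ j, n = j + 2 := ⟨n - 2, by omega⟩
            rw [show j + 2 - 1 = j + 1 by omega, Nat.add_sub_cancel]
            simp only [pow_succ, mul_pow]
            ring
    refine (sum_le_sum hterm).trans ?_
    rw [← mul_sum]
    refine mul_le_mul_of_nonneg_left ?_ hM0
    -- `Σ_{n ∈ [2, N]} y^{n−2} ≤ 1/(1−y)`
    have hI : Icc 2 N = Ico 2 (N + 1) := by ext m; simp only [mem_Icc, mem_Ico]; omega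
    rw [hI, sum_Ico_eq_sum_range]
    have h := geom_sum_Ico_le_of_lt_one hy0 hy (m := 0) (n := N + 1 - 2)
    rw [pow_zero, ← range_eq_Ico] at h
    refine le_trans (le_of_eq (sum_congr rfl fun i _ => ?_)) h
    congr 1
    omega
  -- tail
  have hTail : ∀ N, ψ ^ 1 * exp 1 * V * (Φ * V) ^ N / (1 - Φ * V) ≤ T N := by
    intro N
    have h1 : 0 < 1 - Φ * Vb := sub_pos.2 hθ
    have h2 : 1 - Φ * Vb ≤ 1 - Φ * V := by linarith
    rw [hT, pow_one]
    dsimp only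
    rw [div_eq_mul_inv, div_eq_mul_inv]
    have hinv : (1 - Φ * V)⁻¹ ≤ (1 - Φ * Vb)⁻¹ := inv_anti₀ h1 h2
    have hpowN : (Φ * V) ^ N ≤ (Φ * Vb) ^ N := pow_le_pow_left₀ hθ0 hθle N
    have : 0 ≤ (1 - Φ * V)⁻¹ := inv_nonneg.2 (sub_nonneg.2 hθ1.le)
    gcongr
  have hFO : towerFO D σ μ 1 ≤ F := towerFO_one_le hσ hA' hlam hQ' hμ0 hν0 hμν hprof hx₁ (D := D)
  have hbN : ∀ N, 2 ≤ N → b ≤ F + M * (1 / (1 - Φ * lam * G')) + T N := fun N hN =>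
    (hstep N hN hθ1).trans (add_le_add_three hFO (hGr N) (hTail N))
  have hTto : Filter.Tendsto T Filter.atTop (nhds 0) := by
    have h := (tendsto_pow_atTop_nhds_zero_of_lt_one hθb0 hθ).mul_const ((1 - Φ * Vb)⁻¹) |>.const_mul (ψ * exp 1 * Vb)
    rw [zero_mul, mul_zero] at h
    refine h.congr' (Filter.Eventually.of_forall fun N => ?_)
    rw [hT]
    dsimp only
    rw [div_eq_mul_inv]
    ring
  have hlim : Filter.Tendsto (fun N => F + M * (1 / (1 - Φ * lam * G')) + T N) Filter.atTop (nhds (F + M * (1 / (1 - Φ * lam * G')))) := by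
    have := hTto.const_add (F + M * (1 / (1 - Φ * lam * G')))
    rwa [add_zero] at this
  have hb := ge_of_tendsto hlim (Filter.eventually_atTop.2 ⟨2, fun N hN => hbN N hN⟩)
  refine hb.trans (le_of_eq ?_)
  rw [hF, hM]
  ring

end Summit.HubbardSuperconductivity.HubbardSuperconductivity.Theorems.EngineV8
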